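import Summits.NavierStokesRegularity.NavierStokesRegularity.Theorems.LerayQuarterDissipationFiniteDissipationLiouvilleTraceRegular
import Summits.NavierStokesRegularity.NavierStokesRegularity.Theorems.LerayQuarterDissipationFiniteDissipationLiouvilleTraceSingularSet
import HarnessLib

/-!
# Crux `FiniteDissipationLiouville` (stmt-NavierStokesRegularity-22144): THE FINAL-DATUM PORTRAIT
# THEOREM — what the distributional trace `u(0⁻)` of a member of the stratum `𝒟_{C,K}` looks
# like, with constants depending on `(C, K)` only

Theorems file of route `LerayQuarterDissipation` (lead prover g5; `--supports` the crux). One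
citable theorem assembling the final-datum leaves of leads g3–g5 (files `…FinalTrace`,
`…FiniteSingularSet`, `…TraceMorrey`, `…TraceEpsilon`, `…TraceSingularSet`, `…TraceRegular`).
Navier–Stokes regularity is NOT proved by anything here; no summit is.

`finalDatum_portrait`: for all `C, K` there are constants `c, ε₀, ε₁ > 0`, `M ≥ 0` such that for
EVERY member `u ∈ 𝒟_{C,K}` (Type-I ancient mild, KNSS gauge, quarter-rate dissipation law), writing
`S(u)` for its final-time singular set (points `a` with `u` unbounded on every backward cylinder
`(−ρ², 0) × B(a, ρ)`) and `T_u(ψ) = lim_{t→0⁻} ∫⟪u(t), ψ⟫` for its distributional trace: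

1. (**critical Morrey class**) `|T_u(φ)| ≤ M √r ‖φ‖_{L²}` for every ball `B(x₀, r)` and every test
   field supported in it;
2. (**finitely many singular points**) `S(u)` is finite, `#S(u) ≤ c (K⁺)³`;
3. (**continuous off `S`**) at every `a ∉ S(u)` there are `r > 0` and a field `U₀` continuous on
   `B(a, r)` with `‖u(t, x) − U₀(x)‖ ≤ M'(−t)^α` (`M' ≥ 0`, `α > 0`) on `(−r², 0) × B(a, r)` and
   `T_u(ψ) = ∫⟪U₀, ψ⟫` for test fields supported in `B(a, r/2)`;
4. (**`L³` floor at the singular points**) at every `a ∈ S(u)` and every scale `ρ` some test field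
   supported in `B(a, ρ)` has `|T_u(ψ)| > ε₀ ‖ψ‖_{L^{3/2}}` — so `u(0⁻)` is unbounded and not `L³`
   near `a`;
5. (**`L³` floor at infinity**) if `u` is singular at the apex, then outside every ball `B(0, R)`
   some test field has `|T_u(ψ)| > ε₁ ‖ψ‖_{L^{3/2}}` — so `u(0⁻) ∉ L³({|x| > R})` for every `R`
   and `u(0⁻)` is not compactly supported.

For the two stubs of the line `birth`: the final datum of a counterexample (past-DSS member of the
wall, or past-wandering recurrent member) is a continuous field off finitely many points, blowing
up at the apex (and, for the critical element of seat ns-lqd-p2, ONLY there) at the `L³`-critical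
strength, `L³`-nontrivial at infinity, in `M^{2,1}` — the shape of the homogeneous DSS data
`a(x̂)|x|⁻¹`. NS regularity is not proved by this; no DSS scenario of the wall is removed.
-/

noncomputable section

-- the summit and its single sub-problem share the name (CONVENTIONS §1), as in every Theorems file
set_option linter.dupNamespace false

namespace Summit.NavierStokesRegularity.NavierStokesRegularity.Theorems.FiniteDissipationLiouville.Birth.Apex

open MeasureTheory Set Filter Topology Metric Function TopologicalSpace
open Literature.Analysis Literature.Analysis.FluidPDE
open scoped ENNReal NNReal RealInnerProductSpace

/-- **THE FINAL-DATUM PORTRAIT THEOREM** (see the module docstring for the five clauses). -/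
theorem finalDatum_portrait (C K : ℝ) : ∃ c ε₀ ε₁ M : ℝ, 0 < c ∧ 0 < ε₀ ∧ 0 < ε₁ ∧ 0 ≤ M ∧
    ∀ (u : ℝ → EuclideanSpace ℝ (Fin 3) → EuclideanSpace ℝ (Fin 3)),
      IsTypeIAncientMild C u →
      (∀ s : ℝ, s < 0 → ∫⁻ x, ‖fderiv ℝ (u s) x‖ₑ ^ 2 ≤ ENNReal.ofReal (K / Real.sqrt (-s))) →
      -- (1) critical Morrey class
      (∀ (x₀ : EuclideanSpace ℝ (Fin 3)) (r : ℝ), 0 < r →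
        ∀ φ : EuclideanSpace ℝ (Fin 3) → EuclideanSpace ℝ (Fin 3),
          FunctionSpaces.IsTestFunctionOn (⊤ : Opens (EuclideanSpace ℝ (Fin 3))) φ →
          (∀ x, φ x ≠ 0 → x ∈ ball x₀ r) →
          ∀ L : ℝ, Tendsto (fun t => ∫ x, ⟪u t x, φ x⟫) (𝓝[<] 0) (𝓝 L) →
            |L| ≤ M * Real.sqrt r * Real.sqrt (∫ x, ‖φ x‖ ^ 2)) ∧
      -- (2) finitely many singular points
      (Set.Finite {a : EuclideanSpace ℝ (Fin 3) | ∀ ρ > 0, ∀ M' : ℝ, ∃ t ∈ Ioo (-(ρ ^ 2)) (0 : ℝ),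
          ∃ x ∈ ball a ρ, M' < ‖u t x‖} ∧
        (Set.ncard {a : EuclideanSpace ℝ (Fin 3) | ∀ ρ > 0, ∀ M' : ℝ, ∃ t ∈ Ioo (-(ρ ^ 2)) (0 : ℝ),
          ∃ x ∈ ball a ρ, M' < ‖u t x‖} : ℝ) ≤ c * (max K 0) ^ 3) ∧
      -- (3) continuous final datum off the singular set, attained uniformly
      (∀ a : EuclideanSpace ℝ (Fin 3),
        ¬ (∀ ρ > 0, ∀ M' : ℝ, ∃ t ∈ Ioo (-(ρ ^ 2)) (0 : ℝ), ∃ x ∈ ball a ρ, M' < ‖u t x‖) →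
        ∃ (r : ℝ) (U₀ : EuclideanSpace ℝ (Fin 3) → EuclideanSpace ℝ (Fin 3)) (M' α : ℝ),
          0 < r ∧ 0 ≤ M' ∧ 0 < α ∧ ContinuousOn U₀ (ball a r) ∧
          (∀ t ∈ Ioo (-(r ^ 2)) (0 : ℝ), ∀ x ∈ ball a r, ‖u t x - U₀ x‖ ≤ M' * (-t) ^ α) ∧
          ∀ ψ : EuclideanSpace ℝ (Fin 3) → EuclideanSpace ℝ (Fin 3),
            FunctionSpaces.IsTestFunctionOn (⊤ : Opens (EuclideanSpace ℝ (Fin 3))) ψ →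
            (∀ x, ψ x ≠ 0 → ‖x - a‖ < r / 2) →
            Tendsto (fun t => ∫ x, ⟪u t x, ψ x⟫) (𝓝[<] 0) (𝓝 (∫ x, ⟪U₀ x, ψ x⟫))) ∧
      -- (4) `L³` floor at every singular point, every scale
      (∀ a : EuclideanSpace ℝ (Fin 3),
        (∀ ρ > 0, ∀ M' : ℝ, ∃ t ∈ Ioo (-(ρ ^ 2)) (0 : ℝ), ∃ x ∈ ball a ρ, M' < ‖u t x‖) →
        ∀ ρ > 0, ∃ (ψ : EuclideanSpace ℝ (Fin 3) → EuclideanSpace ℝ (Fin 3)) (T : ℝ),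
          FunctionSpaces.IsTestFunctionOn (⊤ : Opens (EuclideanSpace ℝ (Fin 3))) ψ ∧
            (∀ x, ψ x ≠ 0 → ‖x - a‖ < ρ) ∧
            Tendsto (fun t => ∫ x, ⟪u t x, ψ x⟫) (𝓝[<] 0) (𝓝 T) ∧
            ε₀ * (∫ x, ‖ψ x‖ ^ (3 / 2 : ℝ)) ^ (2 / 3 : ℝ) < |T|) ∧
      -- (5) `L³` floor at infinity for a member singular at the apex
      ((∀ r > 0, ∀ M' : ℝ, ∃ t ∈ Set.Ioo (-(r ^ 2)) (0 : ℝ),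
          ∃ x ∈ Metric.ball (0 : EuclideanSpace ℝ (Fin 3)) r, M' < ‖u t x‖) →
        ∀ R > 0, ∃ (ψ : EuclideanSpace ℝ (Fin 3) → EuclideanSpace ℝ (Fin 3)) (T : ℝ),
          FunctionSpaces.IsTestFunctionOn (⊤ : Opens (EuclideanSpace ℝ (Fin 3))) ψ ∧
            (∀ x, ψ x ≠ 0 → R < ‖x‖) ∧
            Tendsto (fun t => ∫ x, ⟪u t x, ψ x⟫) (𝓝[<] 0) (𝓝 T) ∧
            ε₁ * (∫ x, ‖ψ x‖ ^ (3 / 2 : ℝ)) ^ (2 / 3 : ℝ) < |T|) := by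
  obtain ⟨c, hc, hfin⟩ := exists_finite_singularSet
  obtain ⟨ε₀, hε₀, hfloor⟩ := trace_L3_floor_at_singular C K
  obtain ⟨ε₁, hε₁, hfar⟩ := trace_L3_farField_floor_of_singular C K
  obtain ⟨M, hM0, hMorrey⟩ := exists_trace_morrey_bound K
  refine ⟨c, ε₀, ε₁, M, hc, hε₀, hε₁, hM0, fun u hu hlaw => ⟨?_, hfin C K u hu hlaw, ?_, ?_, ?_⟩⟩
  · exact fun x₀ r hr φ hφ hsupp L hL => hMorrey C u hu hlaw x₀ r hr φ hφ hsupp L hL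
  · exact fun a ha => exists_finalDatum_near_regular hu hlaw ha
  · exact fun a ha ρ hρ => hfloor u hu hlaw a ha ρ hρ
  · exact fun hsing R hR => hfar u hu hlaw hsing R hR

end Summit.NavierStokesRegularity.NavierStokesRegularity.Theorems.FiniteDissipationLiouville.Birth.Apex

end
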